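import Summits.ResolutionOfSingularities.ResolutionOfSingularities.Theorems.WildConesCampaignW46ForcedAtomsMeasure
import Summits.ResolutionOfSingularities.ResolutionOfSingularities.Theorems.WildConesCampaignW46SurfaceBranching
import Summits.ResolutionOfSingularities.ResolutionOfSingularities.Theorems.WildConesCampaignW46ClassicalMuDrop
import Summits.ResolutionOfSingularities.ResolutionOfSingularities.Theorems.MarkedTransferCampaignW46FiniteExitBoundGlue
import HarnessLib

/-!
# [OURS · L1 W4.6, rung (i) SURFACES IN 3-SPACE and CURVES IN THE PLANE, GEOMETRIC FORM — brick 33] The typed Th. 16.6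
# procedure has a FINITE LOCAL EXIT BOUND in the forced-atom regime WITH FINITELY MANY SINGULAR POINTS
# (`FinLocalExitBound`, hence `PermissiblyTerminates` and `Terminates N Rd` for every notion instance), `n ≤ 2`,
# every characteristic, `K` algebraically closed

Cell res-hironaka (LADDER-RESOLUTION rung L, D-0089), slot W4.6 «restricted regimes as rungs», seat res-L1-s46-pv-2
(gen 5). Host: route `WildCones`, crux `ClassicalRegimes` (stmt-ResolutionOfSingularities-16884),
`--supports … --as helper`.

HONEST FRAMING. Everything here is OURS. NOTHING below is a statement of H. Hironaka's manuscript [Hironaka2017] and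
nothing asserts that any statement of it holds: res-L1-s46-pv-1's résumé-free vocabulary and res-L1-type-o1's typed
procedure (`FinLocalExitBound`, `PermissiblyTerminates`, `Terminates`, `Regime.isolatedSing`), res-L1-s46-pv-9's run
layer (`finLocalExitBound_of_stepMeasureDrop`, `stepMeasureDrop_of_offCentre_of_centre`, `transform_germ_eq_off_centre`)
and the typed candidate carriers of row 001 enter as DEFINITIONS; the mathematics is this seat's dictionary (bricks
1–32) over route `WildCones`' own calculus. No FACT-LIST premise is used. AI review is weaker than expert review.

## THE REGIME (stated as a hypothesis `hRg` on an arbitrary regime `Rg`, def-free): «FORCED ATOMS WITH FINITELY MANY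
## SINGULAR POINTS in `n + 1` variables» — at the state `(A, E)`: `E.b = p`; `Sing(E)` is a FINITE set of CLOSED points
## (`Regime.isolatedSing`); and at every `ξ ∈ Sing(E)`: embedding dimension `n + 1`, SOME presentation
## `𝒪̂_{Z,ξ} ≅ K⟦z,u⟧` of `J_ξ` by a unit times a height-one atom `z^p − ser c₀`, and EVERY presentation isolated
## (`Isol c₀`). This is res-L1-type-o1's `Regime.forcedAtom n` (p517839) with the clause «`Sing(E)` has AT MOST ONE point»
## replaced by «`Sing(E)` finite»: a surface in a smooth threefold may now have any finite number of isolated forced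
## `p`-fold points, and a blow-up may create several.

## What is proved (`K` algebraically closed of characteristic `p`)

* `finLocalExitBound_of_calculus` — general `n ≥ 1` under three calculus hypotheses ((ord) forced successor ⇒ order
  `≥ p + 1`; (cnt) at most `3` canonical forced successor data; (μ) `MuDrop p n K`): `FinLocalExitBound Rg` with
  `β(A, E, x) = 4^{μ(x)}`, `μ(x)` the Milnor number of the point. Proof: pv-9's run layer with the per-point measure
  `4^μ`; off the centre the germ does not change (brick 32 transport); over the centre at most three singular points
  (bricks 27–31) each of Milnor number `≤ μ − 1` (route `WildCones`' Milnor drop), so the fibre sum drops.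
* **`finLocalExitBound_of_le_forcedAtomsSurface`** — `n = 2`, SURFACES IN 3-SPACE, EVERY `p`: the three hypotheses are
  this seat's structure lemma (p469938), branching bound (brick 29, p547594) and Milnor drop (p480270).
* **`finLocalExitBound_of_le_forcedAtomsCurve`** — `n = 1`, CURVES `z^p = a(u)` IN A SMOOTH SURFACE, every `p`.
* `permissiblyTerminates_of_le_forcedAtoms{Surface,Curve}`, `terminates_of_le_forcedAtoms{Surface,Curve}` — the
  résumé-free and the typed rungs (every notion instance `N`, every reading `Rd`).

NOT claimed: `n ≥ 3` with `p` odd (no branching bound proved; `p = 2` would need one too); perfect non-closed `K`.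
References: this seat's bricks and HOME/L/res-L1-s46-pv-2/RUNG-I-FORCED-ATOM-SUMMARY.md; H. Hironaka, ms. 2017,
Th. 16.6 p.84, Th. 16.13 p.87 l.26–28 — ROLE of «the procedure ends after finitely many steps» restricted to this
regime only, under adjudication, not cited as fact. [folklore]
-/

noncomputable section

-- single-problem summit: the doubled namespace component `ResolutionOfSingularities` is forced
set_option linter.dupNamespace false

open scoped BigOperators Classical
open MvPowerSeries IsLocalRing

namespace Summit.ResolutionOfSingularities.ResolutionOfSingularities.Theorems

namespace CampaignW46.ForcedAtom

open CategoryTheory AlgebraicGeometry TopologicalSpace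
open Literature.AlgebraicGeometry.Resolution
open Literature.AlgebraicGeometry.Hironaka2017.S02Preliminaries
open Literature.AlgebraicGeometry.Hironaka2017.Datum
open Scheme.IdealSheafData
open WildCones
open CampaignW46.ChartPoint CampaignW46.AtomGerm CampaignW46.FormalChart

variable {p : ℕ} [Fact p.Prime] {K : Type} [Field K] [CharP K p] [IsAlgClosed K] {n : ℕ}

/-! ## General `n`: the finite local exit bound from the three calculus hypotheses -/

/-- [OURS · L1 W4.6 rung (i) with finitely many singular points, general `n ≥ 1` — replaces the role of the termination
clause of Th. 16.13 p.87 l.26–28 / the uniform bound shape of Eq. (127) p.84 (H. Hironaka, ms. 2017) RESTRICTED to the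
forced-atom regime with finite singular locus; NOT a statement of the manuscript] Under the calculus hypotheses (ord),
(cnt), (μ) in `n` variables, every regime contained in «forced atoms with finitely many singular points in `n + 1`
variables» has `FinLocalExitBound` (with `β = 4^μ`). [folklore] -/
theorem finLocalExitBound_of_calculus (hn : 0 < n)
    (hord : ∀ (a : (Fin n → ℕ) → K) (i : Fin n) (τ : Fin n → K), MultP p n K a →
      Isol p n K (step p n K i τ a) → MultP p n K (step p n K i τ a) →
        ser p n K a ∈ maximalIdeal (MvPowerSeries (Fin n) K) ^ (p + 1))
    (hcnt : ∀ (a : (Fin n → ℕ) → K), MultP p n K a → ∀ T : Finset (Fin n × (Fin n → K)),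
      (∀ d ∈ T, Isol p n K (step p n K d.1 d.2 a) ∧ MultP p n K (step p n K d.1 d.2 a) ∧
        ∀ l : Fin n, l ≤ d.1 → d.2 l = 0) → T.card ≤ 3)
    (hmu : MuDrop p n K) (Rg : Regime p K)
    (hRg : ∀ (A : AmbientDatum p K) (E : IdealExponent A.Z), Rg A E →
      E.b = p ∧ Regime.isolatedSing A E ∧ ∀ ξ ∈ E.sing,
        (maximalIdeal (A.Z.presheaf.stalk ξ)).spanFinrank = n + 1 ∧
        (∃ (E₀ : AdicCompletion (maximalIdeal (A.Z.presheaf.stalk ξ)) (A.Z.presheaf.stalk ξ) ≃+*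
            MvPowerSeries (Option (Fin n)) K)
          (f₀ : A.Z.presheaf.stalk ξ) (c₀ : (Fin n → ℕ) → K) (w₀ : MvPowerSeries (Option (Fin n)) K),
          stalkIdeal E.J ξ = Ideal.span {f₀} ∧ IsUnit w₀ ∧
            E₀ (algebraMap _ _ f₀) = w₀ * ((X none : MvPowerSeries (Option (Fin n)) K) ^ p -
              rename (some : Fin n → Option (Fin n)) (ser p n K c₀))) ∧
        (∀ (E₀ : AdicCompletion (maximalIdeal (A.Z.presheaf.stalk ξ)) (A.Z.presheaf.stalk ξ) ≃+*
            MvPowerSeries (Option (Fin n)) K)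
          (f₀ : A.Z.presheaf.stalk ξ) (c₀ : (Fin n → ℕ) → K) (w₀ : MvPowerSeries (Option (Fin n)) K),
          stalkIdeal E.J ξ = Ideal.span {f₀} → IsUnit w₀ →
            E₀ (algebraMap _ _ f₀) = w₀ * ((X none : MvPowerSeries (Option (Fin n)) K) ^ p -
              rename (some : Fin n → Option (Fin n)) (ser p n K c₀)) → Isol p n K c₀)) :
    FinLocalExitBound Rg := by
  classical
  refine finLocalExitBound_of_stepMeasureDrop (fun A E h => (hRg A E h).2.1.1)
    (fun A E x => 4 ^ sInf {m : ℕ | ∃ (E₀ : AdicCompletion (maximalIdeal (A.Z.presheaf.stalk x))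
        (A.Z.presheaf.stalk x) ≃+* MvPowerSeries (Option (Fin n)) K)
        (f₀ : A.Z.presheaf.stalk x) (c₀ : (Fin n → ℕ) → K) (w₀ : MvPowerSeries (Option (Fin n)) K),
        stalkIdeal E.J x = Ideal.span {f₀} ∧ IsUnit w₀ ∧
          E₀ (algebraMap _ _ f₀) = w₀ * ((X none : MvPowerSeries (Option (Fin n)) K) ^ p -
            rename (some : Fin n → Option (Fin n)) (ser p n K c₀)) ∧ m = mu p n K c₀})
    (stepMeasureDrop_of_offCentre_of_centre _ ?_ ?_)
  · -- off the centre the germ of the transform is the germ downstairs (brick 32 transport)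
    intro A A' E E' D π _ _ _ _ _ _ hπ hEE' ξ' hoff _
    subst hEE'
    obtain ⟨e, he, -⟩ := transform_germ_eq_off_centre hπ E hoff
    dsimp only
    rw [← he, sInf_mu_eq_of_ringEquiv e (stalkIdeal E.J (π ξ'))]
  · -- over the centre: the centre is a closed singular point `ξ`, and the fibre sum of `4^μ` drops (brick 32)
    intro A A' E E' D π hRgE hRgE' _ _ hD hhom hπ hEE' η hη t ht
    subst hEE'
    obtain ⟨hb, hisoE, hgerm⟩ := hRg A E hRgE
    obtain ⟨-, hisoE', hgerm'⟩ := hRg A' _ hRgE'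
    obtain ⟨ξ, hξS, -, hDξ⟩ := IsPermissibleCentre.exists_eq_singleton_of_isolatedSing hD hisoE
    have hηξ : η = ξ := by
      have h : η ∈ ({ξ} : Set A.Z) := hDξ ▸ hη
      exact h
    subst hηξ
    obtain ⟨hd, hex, hall⟩ := hgerm η hξS
    have hiso' : ∀ ξ' ∈ (E.transform π D).sing, IsClosed ({ξ'} : Set A'.Z) ∧
        ∀ (E₀' : AdicCompletion (maximalIdeal (A'.Z.presheaf.stalk ξ')) (A'.Z.presheaf.stalk ξ') ≃+*
            MvPowerSeries (Option (Fin n)) K)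
          (f₀' : A'.Z.presheaf.stalk ξ') (c' : (Fin n → ℕ) → K) (w' : MvPowerSeries (Option (Fin n)) K),
          stalkIdeal (E.transform π D).J ξ' = Ideal.span {f₀'} → IsUnit w' →
            E₀' (algebraMap _ _ f₀') = w' * ((X none : MvPowerSeries (Option (Fin n)) K) ^ p -
              rename (some : Fin n → Option (Fin n)) (ser p n K c')) → Isol p n K c' :=
      fun ξ' hξ' => ⟨hisoE'.2 hξ', (hgerm' ξ' hξ').2.2⟩
    exact sum_pow_mu_lt_of_calculus hn hord hcnt hmu π D hπ hhom hb hDξ hξS hd hex hall hiso' t ht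

/-! ## `n = 1`: the (trivial) calculus hypotheses for curves `z^p = a(u)` -/

omit [Fact p.Prime] [CharP K p] [IsAlgClosed K] in
/-- For `n = 1` a state of multiplicity `p` has order `≥ p + 1`: the monomial `u^p` is deleted by cleaning. [folklore] -/
theorem ser_mem_maximalIdeal_pow_succ_of_multP_one (a : (Fin 1 → ℕ) → K) (hM : MultP p 1 K a) :
    ser p 1 K a ∈ maximalIdeal (MvPowerSeries (Fin 1) K) ^ (p + 1) := by
  refine SurfaceBranching.ser_mem_maximalIdeal_pow a fun A hA => ?_
  have hge : p ≤ Finset.sum Finset.univ (fun l => A l) := hM.2 A hA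
  have hne : Finset.sum Finset.univ (fun l => A l) ≠ p := by
    intro h
    apply hA
    refine OrdPExitSurface.clean_apply_of_dvd a A fun l => ?_
    have : A l = p := by
      rw [Fin.sum_univ_one] at h
      rwa [Subsingleton.elim l 0]
    rw [this]
  omega

omit [Fact p.Prime] [CharP K p] [IsAlgClosed K] in
/-- For `n = 1` there is at most ONE canonical chart datum: `(0, 0)`. [folklore] -/
theorem card_le_three_of_canonical_one (a : (Fin 1 → ℕ) → K) (T : Finset (Fin 1 × (Fin 1 → K)))
    (hT : ∀ d ∈ T, Isol p 1 K (step p 1 K d.1 d.2 a) ∧ MultP p 1 K (step p 1 K d.1 d.2 a) ∧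
      ∀ l : Fin 1, l ≤ d.1 → d.2 l = 0) : T.card ≤ 3 := by
  have hsub : T ⊆ {((0 : Fin 1), (0 : Fin 1 → K))} := by
    intro d hd
    rw [Finset.mem_singleton, Prod.ext_iff]
    refine ⟨Subsingleton.elim _ _, funext fun l => (hT d hd).2.2 l ?_⟩
    rw [Subsingleton.elim l d.1]
  exact (Finset.card_le_card hsub).trans (by simp)

/-! ## The rungs: surfaces in 3-space (`n = 2`) and curves in the plane (`n = 1`), every `p` -/

/-- [OURS · L1 W4.6 rung (i) SURFACES IN 3-SPACE, GEOMETRIC FORM; replaces the role of the termination clause of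
Th. 16.13 p.87 l.26–28 (H. Hironaka, ms. 2017) RESTRICTED to surfaces `z^p = a(u₁,u₂)` in a smooth threefold with
FINITELY MANY isolated forced `p`-fold points, the bound being uniform along finite permissible sequences; NOT a
statement of the manuscript] **For every prime `p` and every algebraically closed `K` of characteristic `p`, every regime
contained in «forced atoms with finitely many singular points in `3` variables» has `FinLocalExitBound`** (β = `4^μ`).
[folklore] -/
theorem finLocalExitBound_of_le_forcedAtomsSurface (Rg : Regime p K)
    (hRg : ∀ (A : AmbientDatum p K) (E : IdealExponent A.Z), Rg A E →
      E.b = p ∧ Regime.isolatedSing A E ∧ ∀ ξ ∈ E.sing,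
        (maximalIdeal (A.Z.presheaf.stalk ξ)).spanFinrank = 2 + 1 ∧
        (∃ (E₀ : AdicCompletion (maximalIdeal (A.Z.presheaf.stalk ξ)) (A.Z.presheaf.stalk ξ) ≃+*
            MvPowerSeries (Option (Fin 2)) K)
          (f₀ : A.Z.presheaf.stalk ξ) (c₀ : (Fin 2 → ℕ) → K) (w₀ : MvPowerSeries (Option (Fin 2)) K),
          stalkIdeal E.J ξ = Ideal.span {f₀} ∧ IsUnit w₀ ∧
            E₀ (algebraMap _ _ f₀) = w₀ * ((X none : MvPowerSeries (Option (Fin 2)) K) ^ p -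
              rename (some : Fin 2 → Option (Fin 2)) (ser p 2 K c₀))) ∧
        (∀ (E₀ : AdicCompletion (maximalIdeal (A.Z.presheaf.stalk ξ)) (A.Z.presheaf.stalk ξ) ≃+*
            MvPowerSeries (Option (Fin 2)) K)
          (f₀ : A.Z.presheaf.stalk ξ) (c₀ : (Fin 2 → ℕ) → K) (w₀ : MvPowerSeries (Option (Fin 2)) K),
          stalkIdeal E.J ξ = Ideal.span {f₀} → IsUnit w₀ →
            E₀ (algebraMap _ _ f₀) = w₀ * ((X none : MvPowerSeries (Option (Fin 2)) K) ^ p -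
              rename (some : Fin 2 → Option (Fin 2)) (ser p 2 K c₀)) → Isol p 2 K c₀)) :
    FinLocalExitBound Rg :=
  have hp : p.Prime := Fact.out
  finLocalExitBound_of_calculus (n := 2) two_pos
    (fun a i τ hM hI' hM' => SurfaceBranching.ser_mem_maximalIdeal_pow_succ_of_forcedSuccessor hp a i τ hM hI' hM')
    (fun a hM T hT => SurfaceBranching.card_le_three_of_forced_successors hp a hM T hT)
    (campaignW46HypersurfacesMuDrop_surface hp K) Rg hRg

/-- [OURS · L1 W4.6 rung (i) CURVES `z^p = a(u)` IN A SMOOTH SURFACE, GEOMETRIC FORM (finitely many singular points);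
NOT a statement of the manuscript] The same for `n = 1`. [folklore] -/
theorem finLocalExitBound_of_le_forcedAtomsCurve (Rg : Regime p K)
    (hRg : ∀ (A : AmbientDatum p K) (E : IdealExponent A.Z), Rg A E →
      E.b = p ∧ Regime.isolatedSing A E ∧ ∀ ξ ∈ E.sing,
        (maximalIdeal (A.Z.presheaf.stalk ξ)).spanFinrank = 1 + 1 ∧
        (∃ (E₀ : AdicCompletion (maximalIdeal (A.Z.presheaf.stalk ξ)) (A.Z.presheaf.stalk ξ) ≃+*
            MvPowerSeries (Option (Fin 1)) K)
          (f₀ : A.Z.presheaf.stalk ξ) (c₀ : (Fin 1 → ℕ) → K) (w₀ : MvPowerSeries (Option (Fin 1)) K),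
          stalkIdeal E.J ξ = Ideal.span {f₀} ∧ IsUnit w₀ ∧
            E₀ (algebraMap _ _ f₀) = w₀ * ((X none : MvPowerSeries (Option (Fin 1)) K) ^ p -
              rename (some : Fin 1 → Option (Fin 1)) (ser p 1 K c₀))) ∧
        (∀ (E₀ : AdicCompletion (maximalIdeal (A.Z.presheaf.stalk ξ)) (A.Z.presheaf.stalk ξ) ≃+*
            MvPowerSeries (Option (Fin 1)) K)
          (f₀ : A.Z.presheaf.stalk ξ) (c₀ : (Fin 1 → ℕ) → K) (w₀ : MvPowerSeries (Option (Fin 1)) K),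
          stalkIdeal E.J ξ = Ideal.span {f₀} → IsUnit w₀ →
            E₀ (algebraMap _ _ f₀) = w₀ * ((X none : MvPowerSeries (Option (Fin 1)) K) ^ p -
              rename (some : Fin 1 → Option (Fin 1)) (ser p 1 K c₀)) → Isol p 1 K c₀)) :
    FinLocalExitBound Rg :=
  have hp : p.Prime := Fact.out
  finLocalExitBound_of_calculus (n := 1) one_pos
    (fun a _ _ hM _ _ => ser_mem_maximalIdeal_pow_succ_of_multP_one a hM)
    (fun a _ T hT => card_le_three_of_canonical_one a T hT)
    (campaignW46HypersurfacesMuDrop_curve hp K) Rg hRg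

/-! ## Résumé-free termination and the typed rungs -/

/-- [OURS · L1 W4.6 rung (i) SURFACES IN 3-SPACE, résumé-free; NOT a statement of the manuscript] No infinite
§2.1-permissible sequence of blow-ups stays inside a regime of forced atoms with finitely many singular points in `3`
variables (`K` algebraically closed, every `p`). [folklore] -/
theorem permissiblyTerminates_of_le_forcedAtomsSurface (Rg : Regime p K)
    (hRg : ∀ (A : AmbientDatum p K) (E : IdealExponent A.Z), Rg A E →
      E.b = p ∧ Regime.isolatedSing A E ∧ ∀ ξ ∈ E.sing,
        (maximalIdeal (A.Z.presheaf.stalk ξ)).spanFinrank = 2 + 1 ∧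
        (∃ (E₀ : AdicCompletion (maximalIdeal (A.Z.presheaf.stalk ξ)) (A.Z.presheaf.stalk ξ) ≃+*
            MvPowerSeries (Option (Fin 2)) K)
          (f₀ : A.Z.presheaf.stalk ξ) (c₀ : (Fin 2 → ℕ) → K) (w₀ : MvPowerSeries (Option (Fin 2)) K),
          stalkIdeal E.J ξ = Ideal.span {f₀} ∧ IsUnit w₀ ∧
            E₀ (algebraMap _ _ f₀) = w₀ * ((X none : MvPowerSeries (Option (Fin 2)) K) ^ p -
              rename (some : Fin 2 → Option (Fin 2)) (ser p 2 K c₀))) ∧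
        (∀ (E₀ : AdicCompletion (maximalIdeal (A.Z.presheaf.stalk ξ)) (A.Z.presheaf.stalk ξ) ≃+*
            MvPowerSeries (Option (Fin 2)) K)
          (f₀ : A.Z.presheaf.stalk ξ) (c₀ : (Fin 2 → ℕ) → K) (w₀ : MvPowerSeries (Option (Fin 2)) K),
          stalkIdeal E.J ξ = Ideal.span {f₀} → IsUnit w₀ →
            E₀ (algebraMap _ _ f₀) = w₀ * ((X none : MvPowerSeries (Option (Fin 2)) K) ^ p -
              rename (some : Fin 2 → Option (Fin 2)) (ser p 2 K c₀)) → Isol p 2 K c₀)) :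
    PermissiblyTerminates Rg :=
  permissiblyTerminates_of_finLocalExitBound (fun A E h => (hRg A E h).2.1.1)
    (finLocalExitBound_of_le_forcedAtomsSurface Rg hRg)

/-- [OURS · L1 W4.6 rung (i) SURFACES IN 3-SPACE, typed form; NOT a statement of the manuscript] The typed Th. 16.6
procedure TERMINATES in every such regime, for every notion instance `N` and every reading `Rd`. [folklore] -/
theorem terminates_of_le_forcedAtomsSurface {m : ℕ} (N : Notions.{0} m) (Rd : Reading p K N) (Rg : Regime p K)
    (hRg : ∀ (A : AmbientDatum p K) (E : IdealExponent A.Z), Rg A E →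
      E.b = p ∧ Regime.isolatedSing A E ∧ ∀ ξ ∈ E.sing,
        (maximalIdeal (A.Z.presheaf.stalk ξ)).spanFinrank = 2 + 1 ∧
        (∃ (E₀ : AdicCompletion (maximalIdeal (A.Z.presheaf.stalk ξ)) (A.Z.presheaf.stalk ξ) ≃+*
            MvPowerSeries (Option (Fin 2)) K)
          (f₀ : A.Z.presheaf.stalk ξ) (c₀ : (Fin 2 → ℕ) → K) (w₀ : MvPowerSeries (Option (Fin 2)) K),
          stalkIdeal E.J ξ = Ideal.span {f₀} ∧ IsUnit w₀ ∧
            E₀ (algebraMap _ _ f₀) = w₀ * ((X none : MvPowerSeries (Option (Fin 2)) K) ^ p -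
              rename (some : Fin 2 → Option (Fin 2)) (ser p 2 K c₀))) ∧
        (∀ (E₀ : AdicCompletion (maximalIdeal (A.Z.presheaf.stalk ξ)) (A.Z.presheaf.stalk ξ) ≃+*
            MvPowerSeries (Option (Fin 2)) K)
          (f₀ : A.Z.presheaf.stalk ξ) (c₀ : (Fin 2 → ℕ) → K) (w₀ : MvPowerSeries (Option (Fin 2)) K),
          stalkIdeal E.J ξ = Ideal.span {f₀} → IsUnit w₀ →
            E₀ (algebraMap _ _ f₀) = w₀ * ((X none : MvPowerSeries (Option (Fin 2)) K) ^ p -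
              rename (some : Fin 2 → Option (Fin 2)) (ser p 2 K c₀)) → Isol p 2 K c₀)) :
    Terminates N Rd Rg ∧ TerminatesNabla N Rd Rg :=
  have h := terminates_of_permissiblyTerminates N Rd (permissiblyTerminates_of_le_forcedAtomsSurface Rg hRg)
  ⟨h, terminatesNabla_of_terminates h⟩

/-- [OURS · L1 W4.6 rung (i) CURVES IN THE PLANE, résumé-free; NOT a statement of the manuscript] The same for
`n = 1`. [folklore] -/
theorem permissiblyTerminates_of_le_forcedAtomsCurve (Rg : Regime p K)
    (hRg : ∀ (A : AmbientDatum p K) (E : IdealExponent A.Z), Rg A E →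
      E.b = p ∧ Regime.isolatedSing A E ∧ ∀ ξ ∈ E.sing,
        (maximalIdeal (A.Z.presheaf.stalk ξ)).spanFinrank = 1 + 1 ∧
        (∃ (E₀ : AdicCompletion (maximalIdeal (A.Z.presheaf.stalk ξ)) (A.Z.presheaf.stalk ξ) ≃+*
            MvPowerSeries (Option (Fin 1)) K)
          (f₀ : A.Z.presheaf.stalk ξ) (c₀ : (Fin 1 → ℕ) → K) (w₀ : MvPowerSeries (Option (Fin 1)) K),
          stalkIdeal E.J ξ = Ideal.span {f₀} ∧ IsUnit w₀ ∧
            E₀ (algebraMap _ _ f₀) = w₀ * ((X none : MvPowerSeries (Option (Fin 1)) K) ^ p -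
              rename (some : Fin 1 → Option (Fin 1)) (ser p 1 K c₀))) ∧
        (∀ (E₀ : AdicCompletion (maximalIdeal (A.Z.presheaf.stalk ξ)) (A.Z.presheaf.stalk ξ) ≃+*
            MvPowerSeries (Option (Fin 1)) K)
          (f₀ : A.Z.presheaf.stalk ξ) (c₀ : (Fin 1 → ℕ) → K) (w₀ : MvPowerSeries (Option (Fin 1)) K),
          stalkIdeal E.J ξ = Ideal.span {f₀} → IsUnit w₀ →
            E₀ (algebraMap _ _ f₀) = w₀ * ((X none : MvPowerSeries (Option (Fin 1)) K) ^ p -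
              rename (some : Fin 1 → Option (Fin 1)) (ser p 1 K c₀)) → Isol p 1 K c₀)) :
    PermissiblyTerminates Rg :=
  permissiblyTerminates_of_finLocalExitBound (fun A E h => (hRg A E h).2.1.1)
    (finLocalExitBound_of_le_forcedAtomsCurve Rg hRg)

end CampaignW46.ForcedAtom

end Summit.ResolutionOfSingularities.ResolutionOfSingularities.Theorems

end
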